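import Mathlib.Combinatorics.SimpleGraph.Connectivity.Connected
import Mathlib.GroupTheory.Nilpotent
import Mathlib.GroupTheory.Index
import Mathlib.GroupTheory.Finiteness
import Literature.Barriers.CriticalPhenomena.SubexponentialGrowthZd
import Literature.Probability.Percolation.CoveringQuotientMap
import HarnessLib

/-!
# Vertex-transitive graphs of polynomial growth: Trofimov's theorem on the automorphism group (Trofimov 1985, Thm. 2)

NAMED FACT (statement only, not proved here).  Source: V. I. Trofimov, *Graphs with polynomial growth*, Math. USSR-Sb. 51 (1985)
405–417 (transl. of Mat. Sb. 123(165) (1984) 407–421), Theorem 2, in the wording of R. G. Möller, *Graphs, permutations and topological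
groups*, arXiv:1008.3062, Theorem 2.17: "Suppose `Γ` is a connected, locally finite graph with polynomial growth, and `G` is a group that
acts transitively on `Γ`.  Then there is a `G`-invariant equivalence relation `∼` with finite classes on the vertex set of `Γ` such that
the quotient of `G` by the kernel of the induced action on `Γ/∼` is a finitely generated, virtually nilpotent group with finite stabilizers
for vertices of `Γ/∼`."  The same statement is W. Woess, *Topological groups and infinite graphs*, Discrete Math. 95 (1991) 373–384,
Theorem 1 ("there is an imprimitivity system `σ` of `G` on `X` with finite blocks, such that `G^σ` is a finitely generated
nilpotent-by-finite group with finite vertex stabilizers on `Γ^σ`"), where a short proof from Losert's structure theorem for locally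
compact groups of polynomial growth is given; Trofimov's own proof uses Gromov's theorem.

Formalisation choices.  "Graph" = `SimpleGraph V`, connected and locally finite; "polynomial growth" = the tree's growth bound
`∃ C D, ∀ x n, |B(x,n)| ≤ C (n+1)^D` on `Literature.Barriers.CriticalPhenomena.ballVolume` (as in the lane's target
`BenjaminiSchramm1996_conj4_polynomialGrowth`); "`G` acts on `Γ`" = a `MulAction A V` by graph automorphisms
(`Literature.Probability.Percolation.IsActionByAut`), transitively; the `G`-invariant equivalence relation is a `Setoid V` with finite
classes preserved by every `a : A`; "the quotient of `G` by the kernel of the induced action on `Γ/∼`" is a group `H` with a SURJECTIVE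
homomorphism `π : A →* H` whose kernel is exactly the set of `a` fixing every class, together with the induced action of `H` on the classes
(`π a • ⟦v⟧ = ⟦a • v⟧`); "finitely generated, virtually nilpotent" = `Group.FG H` and a nilpotent subgroup of finite index; "finite
stabilizers for vertices of `Γ/∼`" = every point stabiliser of `H` on `Quotient ∼` is a finite set.  The quotient GRAPH `Γ/∼` (blocks
adjacent iff some representatives are) is not needed to state the theorem and is not introduced here.
What is NOT here: Trofimov's stronger form (the system can be chosen so that even `Aut(Γ/∼)` has finite vertex stabilisers), his Theorem 1
and Proposition 2.3, and the converse (such a structure forces polynomial growth) —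
`-- TODO(general form): Trofimov 1985 Thm. 1: σ with Aut(Γ^σ) itself discrete, finitely generated and nilpotent-by-finite`.
Used by `Summits/CriticalPhenomena/PercolationContinuityZ3/Theorems/Transplant/AutPolynomialGrowthEndState.lean` (lane prim-bschramm,
seat prim-bschramm-p4): every quasi-transitive graph of polynomial growth with `p_c < 1` carries a quasi-transitive group of
automorphisms with a rank-two `ℤ²`-character killing every vertex stabiliser.
-/

namespace Literature.Combinatorics.SimpleGraph

open Literature.Barriers.CriticalPhenomena (ballVolume)
open Literature.Probability.Percolation (IsActionByAut)

/-- **Trofimov 1985, Theorem 2 (wording of Möller 2010, Thm. 2.17 = Woess 1991, Thm. 1)**: a connected, locally finite graph of polynomial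
growth with a group `A` acting transitively by automorphisms carries an `A`-invariant equivalence relation with FINITE classes such that
the quotient of `A` by the kernel of the induced action on the classes is a finitely generated, virtually nilpotent group acting on the
classes with FINITE point stabilisers.  Unproved here; users take it as a hypothesis `(h : Trofimov1985_polynomialGrowthBlocks)`.
-- TODO(general form): Trofimov's Thm. 1 — the system can be chosen with `Aut(Γ/∼)` itself discrete and nilpotent-by-finite.
[cite: Trofimov1985, Thm. 2] [cite: Moller2010, Thm. 2.17] [cite: Woess1991, Thm. 1] -/
def Trofimov1985_polynomialGrowthBlocks : Prop :=
  ∀ {V : Type} (G : _root_.SimpleGraph V) [G.LocallyFinite] {A : Type} [Group A] [MulAction A V],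
    G.Connected → (∃ C D : ℝ, ∀ (x : V) (n : ℕ), (ballVolume G x n : ℝ) ≤ C * ((n : ℝ) + 1) ^ D) →
    IsActionByAut G A → (∀ u v : V, ∃ a : A, a • u = v) →
      ∃ r : Setoid V, (∀ (a : A) (u v : V), r u v → r (a • u) (a • v)) ∧ (∀ v : V, {u : V | r u v}.Finite) ∧
        ∃ (H : Type) (_ : Group H) (_ : MulAction H (Quotient r)) (π : A →* H),
          Function.Surjective π ∧ (∀ (a : A) (v : V), π a • (Quotient.mk r v) = Quotient.mk r (a • v)) ∧
          (∀ a : A, π a = 1 ↔ ∀ v : V, r (a • v) v) ∧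
          Group.FG H ∧ (∃ N : Subgroup H, N.FiniteIndex ∧ Group.IsNilpotent N) ∧
          ∀ q : Quotient r, {h : H | h • q = q}.Finite

end Literature.Combinatorics.SimpleGraph
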